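import Mathlib
import HarnessLib
import Literature.MathematicalPhysics.QuantumLattice.GaugeGroups
import Literature.MathematicalPhysics.QuantumFieldTheory.ConstructiveQFTWave0
import Literature.MathematicalPhysics.QuantumFieldTheory.UnitaryCayleyChart
import Summits.Ventures.LatticeQCDFlow.Scaling.LatticeEntropy
import Summits.Ventures.LatticeQCDFlow.Scaling.LatticeGibbs
import Summits.Ventures.LatticeQCDFlow.Scaling.LatticeTreeGauge
import Summits.Ventures.LatticeQCDFlow.Scaling.LatticeEntropyGrowthSharp
import Summits.Ventures.LatticeQCDFlow.Scaling.EntropyBudgetMeasure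
import Summits.Ventures.LatticeQCDFlow.Scaling.LatticeEntropyU1
import Summits.Ventures.LatticeQCDFlow.Scaling.LatticeEntropyUN
import Summits.Ventures.LatticeQCDFlow.Scaling.LatticeEntropySUNLaw

/-!
# LatticeQCDFlow / Scaling — the entropy ⇒ ESS budget BETWEEN COUPLINGS (flows from a `β₀`-ensemble)

HONEST FRAMING: exact (Metropolis-corrected) sampling algorithms for lattice gauge theory; figures
of merit are autocorrelation/cost numbers at stated couplings and volumes; no continuum-physics
claim.

`Scaling/EntropyBudgetMeasure.lean` prices an exact flow sampler whose model is a bounded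
perturbation of PRODUCT HAAR: `ESS ≤ C·exp(−D(μ_{Λ,β} ‖ Haar^{⊗E}))` for every model density
`0 < g ≤ C` (`wilson_essM_le`), hence `ESS ≤ C·e^{cL^d}·β^{−s}` with the entropy-growth exponent
`s = κ((d−1)L^d(1/2 − 1/L) − 1/2)` (`wilson_essM_le_rpow`, `SU2.essM_volume_law_two`, …).  What
the field trains, however, are flows that push a THERMALISED ENSEMBLE AT A SMALLER COUPLING `β₀`
(heat-bath / HMC output, or the output of an earlier flow) to `β > β₀`.  For such a model the
right normalisation of the density bound is the sup of the `β₀`-Gibbs density,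
`dμ_{Λ,β₀}/dHaar^{⊗E} ≤ Z_{Λ}(β₀)⁻¹` (`rnDeriv_wilsonMeasure_le`, the action being `≥ 0`): a
diffeomorphic flow `T` with `|det D(T⁻¹)| ≤ J` (it nowhere contracts Haar volume by more than `J`)
pushes `μ_{β₀}` to a model of density `≤ J·Z(β₀)⁻¹` — so the hypothesis below is
`0 < g ≤ J / Z_Λ(β₀)`, with `J` the (inverse-)Jacobian CAPACITY of the flow.

## Results (all `[folklore]`; OURS as statements about lattice gauge flows)

* `rnDeriv_wilsonMeasure_le` — `dμ_{Λ,β}/dHaar^{⊗E} ≤ Z_Λ(β)⁻¹` a.e. (`β ≥ 0`, `Re tr ρ ≤ N`).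
* `log_partitionFunction_ge_of_smallBalls` — the TREE-GAUGE free-energy lower bound as a
  stand-alone inequality: under the small-ball hypothesis (H2) with exponent `κ`,
  `log Z_Λ(β) ≥ −κ((d−1)L^d + 1)/2 · log β − (d·|log a| + b·d²)·L^d` for `β ≥ 1` (the step (1)/(5)
  of `entropyGrowth`, exposed).
* `wilson_essM_le_between_rpow` — THE BETWEEN-COUPLINGS ESS LAW, abstract form: (H2) at the
  reference coupling and an entropy lower bound `s·log β − c·L^d ≤ D(μ_β ‖ Haar^{⊗E})` at the
  target give, for every model `0 < g ≤ J/Z(β₀)` (`1 ≤ β₀`, `1 ≤ β`, any order of `β₀, β`),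
  `ESS(μ_β, g·Haar) ≤ J · e^{(c + d|log a| + b d²)L^d} · β₀^{κ((d−1)L^d+1)/2} · β^{−s}`.
* `U1.essM_between_law`, `UN.essM_between_law` (every `N`), `SUN.essM_between_law` (`N ≥ 1`) —
  the law with NO HYPOTHESIS LEFT, from the tree's `u1EntropyGrowth` / `UN.entropyGrowthLaw` /
  `SUN.entropyGrowthLaw` and `smallBall_u1` / `UN.smallBall_un` / `SUN.smallBalls`:
  `ESS ≤ J · e^{C L^d} · β₀^{κ((d−1)L^d+1)/2} · β^{−κ((d−1)L^d(1/2−1/L) − 1/2)}`, `κ = 1, N², N²−1`.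

READING (THEORY-2.md §3.2 (i), v2.7).  In logarithmic form:
`log J + log(1/ESS) ≥ (κ(d−1)L^d/2)·log(β/β₀) − (κ(d−1)L^d/L + κ/2)·log β − (κ/2)·log β₀ − C·L^d` —
an exact flow sampler from a `β₀`-ensemble to `β` must supply Jacobian capacity
`(n_tr/2)·log(β/β₀)`, EXTENSIVE in the volume and logarithmic in the coupling RATIO, or lose it in
ESS (`SU(3)`, `d = 4`: `12·L^4·log(β/β₀)` to leading order).  This is the ε-robust companion of
the window law `log Lip(T) ≥ c(β − β₀) − C` of `Scaling/ExactTransportBetween.lean` (intensive,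
exactness-only).  The `(L^d/L)·log β` leak and the `O(L^d)` constant are the known slack of the
entropy-growth law; the sharp constant is Chatterjee's free-energy limit, not claimed here.
References: Liu, *Monte Carlo Strategies* §2.5.3 (ESS); Agapiou et al. arXiv:1511.06196 Thm 2.1;
Chatterjee–Diaconis arXiv:1511.01437 Thm 1.1; Chatterjee arXiv:1602.01222 Thm 2.1; Bulgarelli–
Cellini–Nada arXiv:2412.00200 §4.2, App. A (flows between couplings in 4-d `SU(3)`); Abbott et
al. arXiv:2211.07541 §IV.
-/

noncomputable section

open MeasureTheory InformationTheory
open Literature.MathematicalPhysics.QuantumLattice Literature.MathematicalPhysics.QuantumFieldTheory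
open Literature.MathematicalPhysics.QuantumFieldTheory.UnitaryCayley

namespace Summit.Ventures.LatticeQCDFlow.Theory2.Lattice

section General

variable {N : ℕ} {G : Type} [Group G] [TopologicalSpace G] [IsTopologicalGroup G]
  [CompactSpace G] [SecondCountableTopology G] [MeasurableSpace G] [BorelSpace G]
  (ρ : G →* Matrix (Fin N) (Fin N) ℂ)

/-- **The `β`-Gibbs density is at most `Z(β)⁻¹`**: `dμ_{Λ,β}/dHaar^{⊗E} = e^{−βS}/Z ≤ Z⁻¹`
product-Haar-a.e., since the Wilson action is non-negative (`Re tr ρ ≤ N`) and `β ≥ 0`.  This is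
why a flow from a thermalised `β₀`-ensemble with inverse-Jacobian capacity `J` is a model of
density `≤ J/Z(β₀)`. [folklore] -/
theorem rnDeriv_wilsonMeasure_le {d L : ℕ} [NeZero L]
    (hρ : Continuous (ρ : G → Matrix (Fin N) (Fin N) ℂ)) (htr : ∀ g, (ρ g).trace.re ≤ N)
    {β : ℝ} (hβ : 0 ≤ β) :
    ∀ᵐ U ∂(Measure.pi fun _ : Edge d L => haarProbability G),
      (wilsonMeasure (d := d) (L := L) ρ β).rnDeriv
          (Measure.pi fun _ : Edge d L => haarProbability G) U ≤
        (partitionFunction (d := d) (L := L) ρ β)⁻¹ := by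
  set π : Measure (GaugeConfig d L G) := Measure.pi fun _ : Edge d L => haarProbability G with hπ
  have hf := measurable_wilsonDensity (d := d) (L := L) ρ hρ β
  have hZ0 : partitionFunction (d := d) (L := L) ρ β ≠ 0 := partitionFunction_ne_zero ρ hρ β
  have hZtop : partitionFunction (d := d) (L := L) ρ β ≠ ⊤ :=
    ne_top_of_le_ne_top ENNReal.one_ne_top (partitionFunction_le_one ρ htr hβ)
  haveI : IsFiniteMeasure (wilsonWeight (d := d) (L := L) ρ β) :=
    ⟨lt_top_iff_ne_top.mpr hZtop⟩
  have h1 : (wilsonMeasure (d := d) (L := L) ρ β).rnDeriv π =ᵐ[π]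
      (partitionFunction (d := d) (L := L) ρ β)⁻¹ •
        (wilsonWeight (d := d) (L := L) ρ β).rnDeriv π :=
    Measure.rnDeriv_smul_left_of_ne_top' _ _ (ENNReal.inv_ne_top.mpr hZ0)
  have h2 : (wilsonWeight (d := d) (L := L) ρ β).rnDeriv π =ᵐ[π]
      fun U => ENNReal.ofReal (Real.exp (-β * wilsonAction ρ U)) :=
    Measure.rnDeriv_withDensity π hf
  filter_upwards [h1, h2] with U h1U h2U
  rw [h1U, Pi.smul_apply, smul_eq_mul, h2U]
  have hexp : Real.exp (-β * wilsonAction ρ U) ≤ 1 := by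
    rw [Real.exp_le_one_iff]
    have := mul_nonneg hβ (wilsonAction_nonneg (d := d) (L := L) ρ htr U)
    linarith
  calc (partitionFunction (d := d) (L := L) ρ β)⁻¹ * ENNReal.ofReal (Real.exp (-β * wilsonAction ρ U))
      ≤ (partitionFunction (d := d) (L := L) ρ β)⁻¹ * 1 := by
        gcongr
        exact ENNReal.ofReal_le_one.mpr hexp
    _ = (partitionFunction (d := d) (L := L) ρ β)⁻¹ := mul_one _

/-- **The tree-gauge free-energy lower bound, exposed** (step (1) of `entropyGrowth`): under the
small-ball hypothesis (H2) with exponent `κ` — for every `0 < ε ≤ 1` a measurable `B_ε` of Haar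
mass `≥ a·ε^κ` all of whose fourfold products from `{1} ∪ B_ε ∪ B_ε⁻¹` have plaquette action
`≤ b·ε²` — one has, for every `L` and every `β ≥ 1`,
`−κ((d−1)L^d + 1)/2 · log β − (d·|log a| + b·d²)·L^d ≤ log Z_Λ(β)` (tree gauge at scale
`ε = β^{−1/2}`: `Z ≥ Haar(B_ε)^{#E − #V + 1}·e^{−β·bε²·#P}`, `#E − #V + 1 = (d−1)L^d + 1`,
`#P ≤ d²L^d`). [folklore] -/
theorem log_partitionFunction_ge_of_smallBalls {d : ℕ}
    (hρ : Continuous (ρ : G → Matrix (Fin N) (Fin N) ℂ)) (htr : ∀ g, (ρ g).trace.re ≤ N)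
    {κ a b : ℝ} (ha : 0 < a)
    (hab : ∀ ε : ℝ, 0 < ε → ε ≤ 1 → ∃ B : Set G, MeasurableSet B ∧
        a * ε ^ κ ≤ (haarProbability G B).toReal ∧
        ∀ g₁ ∈ insert (1 : G) (B ∪ B⁻¹), ∀ g₂ ∈ insert (1 : G) (B ∪ B⁻¹),
          ∀ g₃ ∈ insert (1 : G) (B ∪ B⁻¹), ∀ g₄ ∈ insert (1 : G) (B ∪ B⁻¹),
            (N : ℝ) - (ρ (g₁ * g₂ * g₃ * g₄)).trace.re ≤ b * ε ^ 2)
    {L : ℕ} [NeZero L] {β : ℝ} (hβ : 1 ≤ β) :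
    -(κ * ((((d : ℝ) - 1) * (L : ℝ) ^ d + 1) / 2) * Real.log β) -
        ((d : ℝ) * |Real.log a| + b * (d : ℝ) ^ 2) * (L : ℝ) ^ d ≤
      Real.log (partitionFunction (d := d) (L := L) ρ β).toReal := by
  have hκ : 0 ≤ κ := nonneg_of_smallBalls (G := G) ha fun ε hε0 hε1 => by
    obtain ⟨B, -, hB, -⟩ := hab ε hε0 hε1
    exact ⟨B, hB⟩
  have hb : 0 ≤ b := by
    obtain ⟨B, -, -, hB⟩ := hab 1 one_pos le_rfl
    have h := hB 1 (Set.mem_insert _ _) 1 (Set.mem_insert _ _) 1 (Set.mem_insert _ _)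
      1 (Set.mem_insert _ _)
    simpa using h
  have hβ0 : 0 < β := by linarith
  have hLd : (0 : ℝ) ≤ (L : ℝ) ^ d := by positivity
  have hlogβ : 0 ≤ Real.log β := Real.log_nonneg hβ
  have hκlog : 0 ≤ κ / 2 * Real.log β := mul_nonneg (by linarith) hlogβ
  set ε : ℝ := β ^ (-(1 / 2 : ℝ)) with hε
  have hε0 : 0 < ε := Real.rpow_pos_of_pos hβ0 _
  have hε1 : ε ≤ 1 := Real.rpow_le_one_of_one_le_of_nonpos hβ (by norm_num)
  obtain ⟨B, hBm, hBa, hBs⟩ := hab ε hε0 hε1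
  have hε2 : β * (b * ε ^ 2) = b := by
    have h2 : ε ^ 2 = β⁻¹ := by
      rw [hε, ← Real.rpow_natCast (β ^ (-(1 / 2 : ℝ))) 2, ← Real.rpow_mul hβ0.le]
      norm_num [Real.rpow_neg_one]
    rw [h2]
    field_simp
  have haε : 0 < a * ε ^ κ := mul_pos ha (Real.rpow_pos_of_pos hε0 κ)
  have hHpos : 0 < (haarProbability G B).toReal := lt_of_lt_of_le haε hBa
  have f5 : Real.log a - κ / 2 * Real.log β ≤ Real.log (haarProbability G B).toReal := by
    have h := Real.log_le_log haε hBa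
    rw [Real.log_mul ha.ne' (Real.rpow_pos_of_pos hε0 κ).ne', Real.log_rpow hε0, hε,
      Real.log_rpow hβ0] at h
    linarith
  have hV : Fintype.card (Site d L) = L ^ d := by simp [ZMod.card, Fintype.card_fin]
  have hEn : Fintype.card (Edge d L) = L ^ d * d := by
    simp [Fintype.card_prod, ZMod.card, Fintype.card_fin]
  have hE : (Fintype.card (Edge d L) : ℝ) = d * (L : ℝ) ^ d := by
    rw [hEn]
    push_cast
    ring
  have hP : (Fintype.card (Plaquette d L) : ℝ) ≤ (d : ℝ) ^ 2 * (L : ℝ) ^ d := by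
    have h1 : Fintype.card (Plaquette d L) =
        L ^ d * Fintype.card {p : Fin d × Fin d // p.1 < p.2} := by
      simp [Fintype.card_prod, ZMod.card, Fintype.card_fin]
    have h2 : Fintype.card {p : Fin d × Fin d // p.1 < p.2} ≤ d * d :=
      (Fintype.card_subtype_le _).trans (by simp)
    have h3 : (Fintype.card (Plaquette d L) : ℝ) ≤ (L : ℝ) ^ d * (d * d : ℝ) := by
      rw [h1]; push_cast; gcongr; exact_mod_cast h2
    nlinarith [h3]
  -- the tree-gauge exponent `n = #E − (#V − 1)`
  set n : ℕ := Fintype.card (Edge d L) - (Fintype.card (Site d L) - 1) with hn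
  have hn0 : (0 : ℝ) ≤ n := Nat.cast_nonneg _
  have hnE' : n ≤ Fintype.card (Edge d L) := by
    rw [hn]
    exact Nat.sub_le _ _
  have hnE : (n : ℝ) ≤ d * (L : ℝ) ^ d := by
    rw [← hE]
    exact_mod_cast hnE'
  have hn_sharp : (n : ℝ) ≤ ((d : ℝ) - 1) * (L : ℝ) ^ d + 1 := by
    rcases Nat.eq_zero_or_pos d with hd | hd
    · subst hd
      have h0 : n = 0 := by rw [hn, hEn]; simp
      rw [h0]
      norm_num
    · have hL1 : 1 ≤ L := Nat.one_le_iff_ne_zero.mpr (NeZero.ne L)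
      have hk : 1 ≤ L ^ d := Nat.one_le_pow _ _ (by omega)
      have h1 : L ^ d - 1 ≤ L ^ d * d :=
        (Nat.sub_le _ _).trans (by simpa using Nat.mul_le_mul_left (L ^ d) hd)
      have h2 : (n : ℝ) = (L : ℝ) ^ d * d - ((L : ℝ) ^ d - 1) := by
        rw [hn, hEn, hV, Nat.cast_sub h1, Nat.cast_sub hk]
        push_cast
        ring
      rw [h2]
      apply le_of_eq
      ring
  -- tree-gauged small balls at `β`
  have f1 : (n : ℝ) * Real.log (haarProbability G B).toReal -
      b * Fintype.card (Plaquette d L) ≤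
        Real.log (partitionFunction (d := d) (L := L) ρ β).toReal := by
    have hSB := treeGaugeSmallBallBound d N G ρ hρ htr L β hβ0.le B hBm (b * ε ^ 2) hBs
    rw [hε2, ← hn] at hSB
    have hpos : 0 < (haarProbability G B).toReal ^ n *
        Real.exp (-(b * Fintype.card (Plaquette d L))) := by positivity
    have h := Real.log_le_log hpos hSB
    rw [Real.log_mul (pow_pos hHpos _).ne' (Real.exp_pos _).ne', Real.log_pow, Real.log_exp] at h
    linarith
  have g5 : (n : ℝ) * (Real.log a - κ / 2 * Real.log β) ≤
      n * Real.log (haarProbability G B).toReal := mul_le_mul_of_nonneg_left f5 hn0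
  have gnk : κ / 2 * Real.log β * n ≤ κ / 2 * Real.log β * (((d : ℝ) - 1) * (L : ℝ) ^ d + 1) :=
    mul_le_mul_of_nonneg_left hn_sharp hκlog
  have gP : b * (Fintype.card (Plaquette d L) : ℝ) ≤ b * ((d : ℝ) ^ 2 * (L : ℝ) ^ d) :=
    mul_le_mul_of_nonneg_left hP hb
  have ga1 : (n : ℝ) * (-|Real.log a|) ≤ n * Real.log a :=
    mul_le_mul_of_nonneg_left (neg_abs_le _) hn0
  have ga3 : (n : ℝ) * |Real.log a| ≤ d * (L : ℝ) ^ d * |Real.log a| :=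
    mul_le_mul_of_nonneg_right hnE (abs_nonneg _)
  linarith

/-- **THE BETWEEN-COUPLINGS ESS LAW, abstract form.**  Small balls (H2) with exponent `κ` at the
reference coupling `β₀ ≥ 1`, and an entropy lower bound `s·log β − c·L^d ≤ D(μ_{Λ,β} ‖ Haar^{⊗E})`
at the target coupling `β ≥ 1`: every model with a measurable density `0 < g ≤ J/Z_Λ(β₀)` w.r.t.
product Haar (a flow of inverse-Jacobian capacity `J` from a thermalised `β₀`-ensemble) has
`ESS(μ_{Λ,β}, g·Haar^{⊗E}) ≤ J · exp((c + d|log a| + b d²)·L^d) · β₀^{κ((d−1)L^d+1)/2} · β^{−s}`.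
No order between `β₀` and `β` is needed. [folklore] -/
theorem wilson_essM_le_between_rpow {d : ℕ}
    (hρ : Continuous (ρ : G → Matrix (Fin N) (Fin N) ℂ)) (htr : ∀ g, (ρ g).trace.re ≤ N)
    {κ a b : ℝ} (ha : 0 < a)
    (hab : ∀ ε : ℝ, 0 < ε → ε ≤ 1 → ∃ B : Set G, MeasurableSet B ∧
        a * ε ^ κ ≤ (haarProbability G B).toReal ∧
        ∀ g₁ ∈ insert (1 : G) (B ∪ B⁻¹), ∀ g₂ ∈ insert (1 : G) (B ∪ B⁻¹),
          ∀ g₃ ∈ insert (1 : G) (B ∪ B⁻¹), ∀ g₄ ∈ insert (1 : G) (B ∪ B⁻¹),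
            (N : ℝ) - (ρ (g₁ * g₂ * g₃ * g₄)).trace.re ≤ b * ε ^ 2)
    {L : ℕ} [NeZero L] {β₀ β : ℝ} (hβ₀ : 1 ≤ β₀) (hβ : 1 ≤ β) {s c : ℝ}
    (hD : s * Real.log β - c * (L : ℝ) ^ d ≤ (klDiv (wilsonMeasure (d := d) (L := L) ρ β)
        (Measure.pi fun _ : Edge d L => haarProbability G)).toReal)
    {g : GaugeConfig d L G → ℝ} (hg : Measurable g) {J : ℝ}
    (hg0 : ∀ U, 0 < g U)
    (hgJ : ∀ U, g U ≤ J / (partitionFunction (d := d) (L := L) ρ β₀).toReal) :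
    essM (wilsonMeasure (d := d) (L := L) ρ β)
        ((Measure.pi fun _ : Edge d L => haarProbability G).withDensity
          fun U => ENNReal.ofReal (g U)) ≤
      J * Real.exp ((c + ((d : ℝ) * |Real.log a| + b * (d : ℝ) ^ 2)) * (L : ℝ) ^ d) *
        β₀ ^ (κ * ((((d : ℝ) - 1) * (L : ℝ) ^ d + 1) / 2)) * β ^ (-s) := by
  have hβ₀0 : 0 < β₀ := by linarith
  have hβ0 : 0 < β := by linarith
  have hZpos : 0 < (partitionFunction (d := d) (L := L) ρ β₀).toReal :=
    ENNReal.toReal_pos (partitionFunction_ne_zero ρ hρ β₀)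
      (ne_top_of_le_ne_top ENNReal.one_ne_top (partitionFunction_le_one ρ htr hβ₀0.le))
  have h1 := wilson_essM_le_rpow (d := d) (L := L) ρ hρ htr hβ hD hg hg0 hgJ
  have hJZ : 0 < J / (partitionFunction (d := d) (L := L) ρ β₀).toReal :=
    (hg0 fun _ => 1).trans_le (hgJ fun _ => 1)
  have hJ : 0 < J := by
    have h := mul_pos hJZ hZpos
    rwa [div_mul_cancel₀ _ hZpos.ne'] at h
  have hZ := log_partitionFunction_ge_of_smallBalls (d := d) (L := L) ρ hρ htr ha hab hβ₀
  have hinv : ((partitionFunction (d := d) (L := L) ρ β₀).toReal)⁻¹ ≤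
      Real.exp (((d : ℝ) * |Real.log a| + b * (d : ℝ) ^ 2) * (L : ℝ) ^ d) *
        β₀ ^ (κ * ((((d : ℝ) - 1) * (L : ℝ) ^ d + 1) / 2)) := by
    rw [← Real.exp_log hZpos, ← Real.exp_neg, Real.rpow_def_of_pos hβ₀0, ← Real.exp_add]
    exact Real.exp_le_exp.mpr (by linarith)
  refine h1.trans ?_
  have hexp : 0 ≤ Real.exp (c * (L : ℝ) ^ d) := (Real.exp_pos _).le
  have hrpow : 0 ≤ β ^ (-s) := Real.rpow_nonneg hβ0.le _
  have step : J / (partitionFunction (d := d) (L := L) ρ β₀).toReal ≤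
      J * (Real.exp (((d : ℝ) * |Real.log a| + b * (d : ℝ) ^ 2) * (L : ℝ) ^ d) *
        β₀ ^ (κ * ((((d : ℝ) - 1) * (L : ℝ) ^ d + 1) / 2))) := by
    rw [div_eq_mul_inv]
    exact mul_le_mul_of_nonneg_left hinv hJ.le
  calc J / (partitionFunction (d := d) (L := L) ρ β₀).toReal * Real.exp (c * (L : ℝ) ^ d) * β ^ (-s)
      ≤ J * (Real.exp (((d : ℝ) * |Real.log a| + b * (d : ℝ) ^ 2) * (L : ℝ) ^ d) *
          β₀ ^ (κ * ((((d : ℝ) - 1) * (L : ℝ) ^ d + 1) / 2))) *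
          Real.exp (c * (L : ℝ) ^ d) * β ^ (-s) :=
        mul_le_mul_of_nonneg_right (mul_le_mul_of_nonneg_right step hexp) hrpow
    _ = J * Real.exp ((c + ((d : ℝ) * |Real.log a| + b * (d : ℝ) ^ 2)) * (L : ℝ) ^ d) *
          β₀ ^ (κ * ((((d : ℝ) - 1) * (L : ℝ) ^ d + 1) / 2)) * β ^ (-s) := by
        rw [show (c + ((d : ℝ) * |Real.log a| + b * (d : ℝ) ^ 2)) * (L : ℝ) ^ d =
            ((d : ℝ) * |Real.log a| + b * (d : ℝ) ^ 2) * (L : ℝ) ^ d + c * (L : ℝ) ^ d by ring,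
          Real.exp_add]
        ring

end General

/-! ## Instances with no hypothesis left -/

/-- **The between-couplings ESS law for compact `U(1)`** (every `d`; `κ = 1`): there is
`C = C(d)` such that for all `L ≥ 2`, `β₀ ≥ 1`, `β ≥ 1` and every model of density
`0 < g ≤ J/Z_Λ(β₀)` w.r.t. product Haar,
`ESS ≤ J · e^{C L^d} · β₀^{((d−1)L^d+1)/2} · β^{−((d−1)L^d(1/2−1/L) − 1/2)}`. [folklore] -/
theorem U1.essM_between_law (d : ℕ) :
    ∃ C : ℝ, ∀ (L : ℕ) [NeZero L], 2 ≤ L → ∀ β₀ β : ℝ, 1 ≤ β₀ → 1 ≤ β →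
      ∀ (g : GaugeConfig d L Circle → ℝ) (J : ℝ), Measurable g → (∀ U, 0 < g U) →
        (∀ U, g U ≤ J / (partitionFunction (d := d) (L := L) u1Rep β₀).toReal) →
          essM (wilsonMeasure (d := d) (L := L) u1Rep β)
              ((Measure.pi fun _ : Edge d L => haarProbability Circle).withDensity
                fun U => ENNReal.ofReal (g U)) ≤
            J * Real.exp (C * (L : ℝ) ^ d) *
              β₀ ^ ((((d : ℝ) - 1) * (L : ℝ) ^ d + 1) / 2) *
              β ^ (-(((d : ℝ) - 1) * (L : ℝ) ^ d * (1 / 2 - 1 / L) - 1 / 2)) := by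
  obtain ⟨c, hc⟩ := U1.u1EntropyGrowth d
  obtain ⟨a, b, ha, hab⟩ := U1.smallBall_u1
  refine ⟨c + ((d : ℝ) * |Real.log a| + b * (d : ℝ) ^ 2),
    fun L _ hL β₀ β hβ₀ hβ g J hg hg0 hgJ => ?_⟩
  have hD := (hc L hL β hβ).1
  have h := wilson_essM_le_between_rpow (d := d) (L := L) u1Rep continuous_u1Rep
    U1.re_trace_u1Rep_le ha hab hβ₀ hβ
    (s := ((d : ℝ) - 1) * (L : ℝ) ^ d * (1 / 2 - 1 / L) - 1 / 2) (c := c) (by linarith) hg hg0 hgJ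
  simpa only [one_mul] using h

/-- **The between-couplings ESS law for `U(N)`** (every `d`, every `N`; `κ = N²`): there is
`C = C(d, N)` such that for all `L ≥ 2`, `β₀ ≥ 1`, `β ≥ 1` and every model of density
`0 < g ≤ J/Z_Λ(β₀)` w.r.t. product Haar,
`ESS ≤ J · e^{C L^d} · β₀^{N²((d−1)L^d+1)/2} · β^{−N²((d−1)L^d(1/2−1/L) − 1/2)}`. [folklore] -/
theorem UN.essM_between_law (d N : ℕ) :
    ∃ C : ℝ, ∀ (L : ℕ) [NeZero L], 2 ≤ L → ∀ β₀ β : ℝ, 1 ≤ β₀ → 1 ≤ β →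
      ∀ (g : GaugeConfig d L (𝔾 N) → ℝ) (J : ℝ), Measurable g → (∀ U, 0 < g U) →
        (∀ U, g U ≤ J / (partitionFunction (d := d) (L := L)
          (unitaryFundamentalRep (Fin N) ℂ) β₀).toReal) →
          essM (wilsonMeasure (d := d) (L := L) (unitaryFundamentalRep (Fin N) ℂ) β)
              ((Measure.pi fun _ : Edge d L => haarProbability (𝔾 N)).withDensity
                fun U => ENNReal.ofReal (g U)) ≤
            J * Real.exp (C * (L : ℝ) ^ d) *
              β₀ ^ ((N : ℝ) ^ 2 * ((((d : ℝ) - 1) * (L : ℝ) ^ d + 1) / 2)) *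
              β ^ (-((N : ℝ) ^ 2 * (((d : ℝ) - 1) * (L : ℝ) ^ d * (1 / 2 - 1 / L) - 1 / 2))) := by
  obtain ⟨c, hc⟩ := UN.entropyGrowthLaw d N
  obtain ⟨a, b, ha, hab⟩ := UN.smallBall_un (N := N)
  refine ⟨c + ((d : ℝ) * |Real.log a| + b * (d : ℝ) ^ 2),
    fun L _ hL β₀ β hβ₀ hβ g J hg hg0 hgJ => ?_⟩
  have hD := (hc L hL β hβ).1
  exact wilson_essM_le_between_rpow (d := d) (L := L) (unitaryFundamentalRep (Fin N) ℂ)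
    (continuous_unitaryFundamentalRep (Fin N) ℂ) UN.re_trace_le ha hab hβ₀ hβ
    (s := (N : ℝ) ^ 2 * (((d : ℝ) - 1) * (L : ℝ) ^ d * (1 / 2 - 1 / L) - 1 / 2)) (c := c)
    (by linarith) hg hg0 hgJ

/-- **THE BETWEEN-COUPLINGS ESS LAW FOR `SU(N)`**, `N ≥ 1` (every `d`; `SU(3)`, `d = 4`
included; `κ = N² − 1`): there is `C = C(d, N)` such that for all `L ≥ 2`, `β₀ ≥ 1`, `β ≥ 1` and
EVERY model on `GaugeConfig d L SU(N)` with a measurable density `0 < g ≤ J/Z_Λ(β₀)` against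
product Haar — in particular the push-forward of a thermalised `β₀`-ensemble under a flow of
inverse-Jacobian capacity `J` — the exact (reweighted / independence-Metropolis) sampler of the
Wilson measure at `β` has
`ESS ≤ J · e^{C L^d} · β₀^{(N²−1)((d−1)L^d+1)/2} · β^{−(N²−1)((d−1)L^d(1/2−1/L) − 1/2)}`, i.e.
`log J + log(1/ESS) ≥ ((N²−1)(d−1)L^d/2)·log(β/β₀) − (N²−1)((d−1)L^d/L + 1/2)·log β −
((N²−1)/2)·log β₀ − C·L^d` (for `SU(3)`, `d = 4`: `12·L^4·log(β/β₀)` to leading order).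
[folklore] -/
theorem SUN.essM_between_law (d N : ℕ) (hN : 1 ≤ N) :
    ∃ C : ℝ, ∀ (L : ℕ) [NeZero L], 2 ≤ L → ∀ β₀ β : ℝ, 1 ≤ β₀ → 1 ≤ β →
      ∀ (g : GaugeConfig d L (Matrix.specialUnitaryGroup (Fin N) ℂ) → ℝ) (J : ℝ),
        Measurable g → (∀ U, 0 < g U) →
        (∀ U, g U ≤ J / (partitionFunction (d := d) (L := L) (fundamentalRep (Fin N)) β₀).toReal) →
          essM (wilsonMeasure (d := d) (L := L) (fundamentalRep (Fin N)) β)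
              ((Measure.pi fun _ : Edge d L =>
                  haarProbability (Matrix.specialUnitaryGroup (Fin N) ℂ)).withDensity
                fun U => ENNReal.ofReal (g U)) ≤
            J * Real.exp (C * (L : ℝ) ^ d) *
              β₀ ^ (((N : ℝ) ^ 2 - 1) * ((((d : ℝ) - 1) * (L : ℝ) ^ d + 1) / 2)) *
              β ^ (-(((N : ℝ) ^ 2 - 1) *
                (((d : ℝ) - 1) * (L : ℝ) ^ d * (1 / 2 - 1 / L) - 1 / 2))) := by
  obtain ⟨c, hc⟩ := SUN.entropyGrowthLaw d N hN
  obtain ⟨a, b, ha, hab⟩ := SUN.smallBalls N hN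
  refine ⟨c + ((d : ℝ) * |Real.log a| + b * (d : ℝ) ^ 2),
    fun L _ hL β₀ β hβ₀ hβ g J hg hg0 hgJ => ?_⟩
  have hD := (hc L hL β hβ).1
  exact wilson_essM_le_between_rpow (d := d) (L := L) (fundamentalRep (Fin N))
    (continuous_fundamentalRep (Fin N)) (SUN.re_trace_le N) ha hab hβ₀ hβ
    (s := ((N : ℝ) ^ 2 - 1) * (((d : ℝ) - 1) * (L : ℝ) ^ d * (1 / 2 - 1 / L) - 1 / 2)) (c := c)
    (by linarith) hg hg0 hgJ

/-- **No Jacobian capacity, no ESS — between couplings** (`SU(N)`, `N ≥ 1`): a model of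
density `≤ Z_Λ(β₀)⁻¹` (capacity `J = 1`, e.g. a Haar-preserving rearrangement of a thermalised
`β₀`-ensemble) has `ESS ≤ e^{C L^d}·β₀^{(N²−1)((d−1)L^d+1)/2}·β^{−(N²−1)((d−1)L^d(1/2−1/L) − 1/2)}`
at `β` — exponentially small in the volume once `log(β/β₀)` beats the per-site slack. [folklore] -/
theorem SUN.essM_between_law_one (d N : ℕ) (hN : 1 ≤ N) :
    ∃ C : ℝ, ∀ (L : ℕ) [NeZero L], 2 ≤ L → ∀ β₀ β : ℝ, 1 ≤ β₀ → 1 ≤ β →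
      ∀ (g : GaugeConfig d L (Matrix.specialUnitaryGroup (Fin N) ℂ) → ℝ),
        Measurable g → (∀ U, 0 < g U) →
        (∀ U, g U ≤ ((partitionFunction (d := d) (L := L) (fundamentalRep (Fin N)) β₀).toReal)⁻¹) →
          essM (wilsonMeasure (d := d) (L := L) (fundamentalRep (Fin N)) β)
              ((Measure.pi fun _ : Edge d L =>
                  haarProbability (Matrix.specialUnitaryGroup (Fin N) ℂ)).withDensity
                fun U => ENNReal.ofReal (g U)) ≤
            Real.exp (C * (L : ℝ) ^ d) *
              β₀ ^ (((N : ℝ) ^ 2 - 1) * ((((d : ℝ) - 1) * (L : ℝ) ^ d + 1) / 2)) *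
              β ^ (-(((N : ℝ) ^ 2 - 1) *
                (((d : ℝ) - 1) * (L : ℝ) ^ d * (1 / 2 - 1 / L) - 1 / 2))) := by
  obtain ⟨C, hC⟩ := SUN.essM_between_law d N hN
  refine ⟨C, fun L _ hL β₀ β hβ₀ hβ g hg hg0 hg1 => ?_⟩
  have h := hC L hL β₀ β hβ₀ hβ g 1 hg hg0 (fun U => by rw [one_div]; exact hg1 U)
  simpa only [one_mul] using h

end Summit.Ventures.LatticeQCDFlow.Theory2.Lattice
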